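import Literature.AlgebraicGeometry.HodgeTheory.SupportedHodgeClassDescent
import Literature.AlgebraicGeometry.HodgeTheory.GysinBaseChangeOfKunneth
import Literature.AlgebraicTopology.SingularHomology.CompactGroupExteriorCohomology

/-!
# Route `EndoscopicMiddleDegree` · crux `IsotypicMiddleClassesAlgebraic` (stmt-HodgeConjecture-14301) —
# stub `stub_coverDescent` of line `IdeatorFiveSketch`: algebraicity descends along maps of non-zero degree

Helper for crux `IsotypicMiddleClassesAlgebraic` (stmt-HodgeConjecture-14301), line
`IdeatorFiveSketch` (idea `noncongruence-divisor-ring`): the closing step of the line's composition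
`isotypicMiddleClassesAlgebraic_of` (`Cruxes/IsotypicMiddleClassesAlgebraic/Lines/IdeatorFiveSketch.lean`).

For a morphism `f : X' ⟶ X` of smooth projective complex varieties of the same dimension `n` with
`f_* 1 ≠ 0` in `H⁰(X(ℂ); ℂ)` (non-zero degree) and a class `c ∈ H^{2p}(X(ℂ); ℂ)` whose pull-back
`f^* c` is algebraic on `X'`, the class `c` is algebraic on `X`: by the projection formula
`f_*(f^* c ∪ 1) = c ∪ f_* 1` (`complexGysin_cup`, Fulton, *Young Tableaux*, App. B (6)),
`H⁰(X(ℂ); ℂ) = ℂ · 1` (`exists_eq_smul_one`), so `f_* f^* c = t • c` with `t ≠ 0`, and push-forwards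
of algebraic classes are algebraic (`complexGysin_mem_algebraicClasses` with the proved support
property `gysinMap_restrictCompl_eq_zero_of_field ℂ`). Poincaré duality for the orientation family
is the theorem `OrientationFamily.hasPoincareDuality`.
-/

noncomputable section

namespace Summit.HodgeConjecture.HodgeConjecture.Theorems

set_option linter.dupNamespace false

open CategoryTheory
open Literature.AlgebraicGeometry Literature.AlgebraicGeometry.HodgeTheory
open Literature.AlgebraicGeometry.Motives Literature.AlgebraicTopology.SingularHomology

/-- **Algebraicity descends along maps of non-zero degree** (registered stub `stub_coverDescent` of
line `IdeatorFiveSketch`, crux stmt-HodgeConjecture-14301). For `f : X' ⟶ X` between smooth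
projective complex varieties of the same dimension `n` with `f_* 1 ≠ 0` in `H⁰(X(ℂ); ℂ)`, every
class `c ∈ H^{2p}(X(ℂ); ℂ)` with `f^* c ∈ algebraicClasses X' p` lies in `algebraicClasses X p`
(`f_*(f^* c) = c ∪ f_* 1 = t • c`, `t ≠ 0`, and `f_*` preserves algebraic classes). -/
theorem stub_coverDescent (μ : OrientationFamily) {n : ℕ} {X' X : SchemeOver ℂ}
    (hX' : IsSmoothProjective n X') (hX : IsSmoothProjective n X) (f : X' ⟶ X)
    (hdeg : complexGysin μ hX' hX f (rfl : 0 + 2 * n = 0 + 2 * n)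
      (singularCohomology.one ℂ (ComplexPoints X')) ≠ 0)
    {p : ℕ} (c : complexBetti X (2 * p))
    (hc : complexBetti.map f (2 * p) c ∈ algebraicClasses X' p) :
    c ∈ algebraicClasses X p := by
  have hμ : μ.HasPoincareDuality := OrientationFamily.hasPoincareDuality μ
  -- `f_* 1 = t • 1`, `t ≠ 0`
  obtain ⟨t, ht⟩ := exists_eq_smul_one μ hX
    (complexGysin μ hX' hX f (rfl : 0 + 2 * n = 0 + 2 * n) (singularCohomology.one ℂ (ComplexPoints X')))
  have ht0 : t ≠ 0 := by
    rintro rfl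
    exact hdeg (by rw [ht, zero_smul])
  -- projection formula with `y = 1`
  have hproj := complexGysin_cup hμ hX' hX f (p := 2 * p) (q := 0) (a := 2 * p) (b := 2 * p)
    (q' := 0) (Nat.add_zero _) (rfl : 2 * p + 2 * n = 2 * p + 2 * n) (rfl : 0 + 2 * n = 0 + 2 * n)
    (Nat.add_zero _) c (singularCohomology.one ℂ (ComplexPoints X'))
  rw [cupProduct_one, ht, map_smul, cupProduct_one] at hproj
  -- `f_*(f^* c)` is algebraic
  have halg : complexGysin μ hX' hX f (rfl : 2 * p + 2 * n = 2 * p + 2 * n)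
      (complexBetti.map f (2 * p) c) ∈ algebraicClasses X p :=
    complexGysin_mem_algebraicClasses (gysinMap_restrictCompl_eq_zero_of_field ℂ) μ hμ hX' hX f
      (rfl : p + n = p + n) _ hc
  rw [hproj] at halg
  have : c = t⁻¹ • (t • c) := by rw [smul_smul, inv_mul_cancel₀ ht0, one_smul]
  rw [this]
  exact Submodule.smul_mem _ _ halg

/-- **Degree form.** Same statement with the degree given as a scalar: if `f_* 1 = t • 1` with
`t ≠ 0` and `f^* c` is algebraic then `c` is algebraic. -/
theorem stub_coverDescent_of_eq_smul (μ : OrientationFamily) {n : ℕ}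
    {X' X : SchemeOver ℂ} (hX' : IsSmoothProjective n X') (hX : IsSmoothProjective n X) (f : X' ⟶ X)
    {t : ℂ} (ht0 : t ≠ 0)
    (hdeg : complexGysin μ hX' hX f (rfl : 0 + 2 * n = 0 + 2 * n)
      (singularCohomology.one ℂ (ComplexPoints X')) = t • singularCohomology.one ℂ (ComplexPoints X))
    {p : ℕ} (c : complexBetti X (2 * p))
    (hc : complexBetti.map f (2 * p) c ∈ algebraicClasses X' p) :
    c ∈ algebraicClasses X p := by
  refine stub_coverDescent μ hX' hX f ?_ c hc
  rw [hdeg]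
  intro h
  -- `t • 1 = 0` with `t ≠ 0` forces `1 = 0` in `H⁰(X(ℂ))`, impossible on the non-empty `X(ℂ)`
  have h1 : singularCohomology.one ℂ (ComplexPoints X) = 0 := by
    simpa [ht0] using h
  letI := hX.chartedSpace
  haveI := ComplexPoints.compactSpace_of_isSmoothProjective hX
  haveI := ComplexPoints.t2Space_of_isSmoothProjective hX
  haveI := connectedSpace_complexPoints hX
  haveI := ChartedSpace.locallyPathConnectedSpace (EuclideanSpace ℝ (Fin (2 * n))) (ComplexPoints X)
  haveI : PathConnectedSpace (ComplexPoints X) := pathConnectedSpace_iff_connectedSpace.mpr inferInstance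
  have h2 := congrArg (singularCohomologyZeroEquiv ℂ ℂ (ComplexPoints X)) h1
  rw [singularCohomologyZeroEquiv_one, map_zero] at h2
  exact one_ne_zero h2

end Summit.HodgeConjecture.HodgeConjecture.Theorems

end
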